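import Summits.Schanuel.Schanuel.Theorems.RootDecomp1KRelLiouvilleCell08

/-!
# RootDecomp1KLogLogCell — lens 1, generation 35 «LOG-LOG CELL of 33364» (RootDecomp1KLogLogCell.lean 05ce2a21…, 1940 l) — part 1 (RootDecomp1KLogLogCell01): §1 the classes `LogLogMeasure θ` / `LogLogLiouville ρ`; §2 the rational-root non-vanishing lemma (`eq_zero_of_sum_pow_mul_eq_zero`, `mvspecialise_ne_zero_of_coprime`, `specialise_ne_zero_of_coprime`)

PORT NOTE (census-1 gen 15, 2026-08-31): port of HOME/decomp-schanuel-lens-1/g35/RootDecomp1KLogLogCell.lean (sha256 05ce2a21…c847, 1940 l; own farm rc 0 · 0 warn ·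
0 sorry · axioms std; critic VERDICT STATUS L1698: CHECKLIST K-g35 (1)–(4) MET, ONE cell-decision credit (K-R19 (γ), delivered in the stronger log-log form) to
lens-1 g35, RULE K-R22, PORT GO LOW census lane) in EIGHT parts `RootDecomp1KLogLogCell01`–`08` (the verdict's four-part scheme exceeds the 400-line cap):
01 = §1 classes `LogLogMeasure` / `LogLogLiouville` + §2 the RATIONAL-ROOT NON-VANISHING LEMMA, 02 = §3 extraction, 03 = §4 first half (scale index, factorial
bookkeeping), 04 = §4 THE INDUCED MEASURE v2 `induced_logLog_measure_cons_liouvilleNumber` / `logLogMeasure_cons_liouvilleNumber` + §5 the `Fin 1` instances,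
05 = §6 first half (the member coordinate `ρ_E = Σ_J 2^{-(2J)!}`, `logLogLiouville_rhoE`), 06 = §6 `rhoE_sub_rat_lower_logsq` / `not_logSqLiouville_rhoE`, 07 = §7 the
shared-digit certificate, 08 = §8 the cells against item 33364, the corollaries for the TREE classes by name, the members `z_E`, `z_E^π`. Imports the TREE
`RootDecomp1KRelLiouvilleCell08` (this seat's port of g34) — no toolkit restatement; `set_option linter.dupNamespace false` dropped; 22 one-line docstrings added;
fifteen generic real/ℕ one-liners made `private` with per-part private copies (gate dedup lint); ONE scoped `maxHeartbeats 400000` added on `rhoE_sub_rat_lower_logsq` (deterministic timeout at the default budget once the file is split; passes whole); statements and proofs verbatim; `hNW : NWMeasure` stays a binder BY NAME.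
`--supports stmt-Schanuel-33364`; no census credit. Nothing here proves Schanuel; rung 0. The lens's header follows.
-/

/-!
# RootDecomp1K — lens 1 (grading / quantitative ladder), gen 35: the «LOG-LOG CELL» of item 33364
# (`FiniteOrderLiouvilleSchanuel`, A₄ᵈ) — Schanuel's bound on `{(1, ℓ₂, ρ) : ρ log-log-Liouville}` ⊋ the
# LOG-SQUARE-LIOUVILLE cell (RULE K-R19 (γ), tree class `RootDecomp1KGeneric.LogSqLiouville` BY NAME) ⊋ g34's
# log-hyper cell; π-twin HYPOTHESIS-FREE; explicit certified member `z_E = (1, ℓ₂, ρ_E)` OUTSIDE g34's cell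

Cell decomp-schanuel, seat `decomp-schanuel-lens-1`, gen 35 (2026-08-31); the ONE K-R19 (γ) credit reserved to lens 1
(STATUS L1658 VERDICT g34; claim L1668; ACK + CHECKLIST K-g35 L1670).  Route of record `route-Schanuel-RootDecomp1K`
(DRAFT; `closes hL hH hF hB`), item **F** = `Summit.Schanuel.Schanuel.Theses.RootDecomp1K.FiniteOrderLiouvilleSchanuel`
(stmt-Schanuel-33364).  Nothing here proves Schanuel; rung 0.  No 1K decl is restated: the item is consumed BY NAME in
the probe file (`LLprobe.lean`).  Imports tree Theorems only (`…RootDecomp1KRelLiouvilleCell08` = g34 ported, census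
g15 p811756…p812288); the e-versions carry the tree's by-name fact binder `(hNW : NWMeasure)` exactly as g34 / Hyper01
prescribe (the fact's proof cone `…ExpOneTranscendenceMeasureParams` is not built on the check farm); π-versions nothing.

## What is new relative to g34 (K-R19: «(γ) the log-square cell via a GENUINELY NEW MEASURE (not a re-instantiation
## of §4 with k = 2)»)
g34's induced measure loses ONE LOGARITHM PER DEGREE: `|Q(ℓ₂, θ)| ≥ exp(−(C(1+log len Q))^{d+2})`, because it needs
a WINDOW of `d + 1` consecutive scales `2^{N!}, …, 2^{(N+d)!}` (one of `d + 1` distinct rationals is not a root of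
the specialised polynomial) and `(N+d)! ≈ N!·N^d ≈ log L · (loglog L)^d`.  A log-square-Liouville `ρ` only beats
`exp(−m (log q)²)`, so g34's engine is SILENT on the (γ) cell for every `d ≥ 1`.
THE NEW MEASURE (§4) uses ONE scale: for `N ≥ 2` the convergent `s_N = p_N / 2^{N!}` of `ℓ₂` has ODD numerator, so
it is in lowest terms with denominator `q = 2^{N!} > len`-anything, and the RATIONAL-ROOT / GAUSS-LEMMA NON-VANISHING
LEMMA (§2: `q > mvlen Q`, `gcd(a, q) = 1 ⇒ q^K Q(a/q, X⃗) ≠ 0` in `ℤ[X⃗]`) replaces the window.  Result, EXPONENT-FREE: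
`MvPolyMeasure θ ⇒ ∀ d, ∃ C > 0, ∀ Q ≠ 0, totalDegree Q ≤ d → exp(−C·(1+log len Q)·(1+log(1+log len Q))) ≤ ‖Q(ℓ₂, θ)‖`
(`induced_logLog_measure_cons_liouvilleNumber`; the `loglog` is the price of `N! ≤ N·(N−1)!`, one factorial step above
the first admissible scale; `N := max(N_d, first admissible)`, `N_d = d(τ+1) + 2` a `d`-dependent constant, so that
BOTH `2^{N!} ≥ Y = 4ΓC₁·len^{1+τ}` AND the degree bookkeeping hold — cf. the critic's sanity remark in K-g35).
Consequently the third coordinate only has to beat `exp(−m · log q · loglog q)`: the LOG-LOG-LIOUVILLE reals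
(`LogLogLiouville ρ : ∀ m, ∃ r, m ≤ r.den ∧ ρ ≠ r ∧ |ρ − r| < exp(−m · log r.den · log log r.den)`), a class
STRICTLY LARGER than `LogSqLiouville` (`logLogLiouville_of_logSqLiouville`), itself ⊋ g34's `LogHyperLiouville`.

## Content (sorry-free; axioms `propext, Classical.choice, Quot.sound`)
* §1 classes `LogLogMeasure θ`, `LogLogLiouville ρ` + ladder lemmas (`logLogMeasure_of_mvPolyMeasure`,
  `LogLogMeasure.logPowMeasure` (⇒ g34's class with k = 2), `LogLogMeasure.mvWeakMeasure`,
  `logLogLiouville_of_logSqLiouville/_of_logHyperLiouville/_of_hyperLiouville`, `LogLogLiouville.liouville`).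
* §2 THE RATIONAL-ROOT NON-VANISHING LEMMA over `ℤ[X⃗]`: `eq_zero_of_sum_pow_mul_eq_zero`,
  `mvspecialise_ne_zero_of_coprime (hlen : ∀ k, mvlen (G k) < q) (hcop : IsCoprime a q)`, `specialise_ne_zero_of_coprime`.
* §3 EXTRACTION `LogLogMeasure θ ∧ LogLogLiouville ρ ⇒ (ρ, θ)` algebraically independent ⇒
  `sb_of_logLogLiouville_of_logLogMeasure`.
* §4 THE INDUCED LOG-LOG MEASURE `induced_logLog_measure_cons_liouvilleNumber (hθ : MvPolyMeasure θ) (d)` — standalone,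
  no named fact, no hidden exponent, no window; class form `logLogMeasure_cons_liouvilleNumber`.
* §5 instances `logLogMeasure_liouvilleNumber_pi` (UNCONDITIONAL) / `logLogMeasure_liouvilleNumber_exp_one (hNW)`.
* §6 THE MEMBER COORDINATE `ρ_E := Σ_J 2^{−(2J)!}` (even-index sub-series of ℓ₂'s skeleton): `logLogLiouville_rhoE`
  (hypothesis-free) and the effective measure `rhoE_sub_rat_lower_logsq : q ≥ 4 → exp(−271 (log q)²) ≤ |ρ_E − p/q|`,
  whence `not_logSqLiouville_rhoE`, `not_logHyperLiouville_rhoE`, `not_hyperLiouville_rhoE`: the member is OUTSIDE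
  g34's cell and outside the route's hyper-Liouville class.
* §7 THE SHARED-DIGIT CERTIFICATE for `(1, ℓ₂, ρ_E)`: `formE_lower_bound (h ≠ 0) : exp(−(1+Σ|hᵢ|)^11) ≤ |h₀ + h₁ℓ₂ + h₂ρ_E|`
  (digits `h₁ + h₂·1_{2ℕ}(k)`; tree `digit_lower_bound`, `factorial_pos_le_pow` from g34's port).
* §8 THE CELL THEOREMS with 33364's binders VERBATIM + ONE cell line after `LinearIndependent ℚ z`:
  `finiteOrderLiouvilleSchanuel_logLogCell (hNW) (hρ : LogLogLiouville ρ)` (cell `Set.range z = Set.range ![1, ℓ₂, ρ]`),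
  `…_logLogCell_pi (hρ)` (cell `![π, πℓ₂, πρ]`, HYPOTHESIS-FREE); COROLLARIES for the TREE classes BY NAME:
  `…_logSqCell (hNW) (hρ : RootDecomp1KGeneric.LogSqLiouville ρ)` / `…_logSqCell_pi (hρ)` = the literal (γ) text,
  `…_logHyperCell (hNW) (hρ : RootDecomp1KRelLiouvilleCell.LogHyperLiouville ρ)` / `_pi` (g34 ⊂ g35),
  `…_hyperCell_pi (hρ : RootDecomp1KHyper.HyperCell.HyperLiouville ρ)`.  THE MEMBERS `zE = ![1, ℓ₂, ρ_E]`,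
  `zEpi = ![π, πℓ₂, πρ_E]`: (i) `linearIndependent_zE/zEpi`, (ii) `linLiouville_zE/zEpi`, (iii)
  `not_hyperLinLiouville_zE/zEpi` — ALL HYPOTHESIS-FREE (`zE_in_scope_33364`, `zEpi_in_scope_33364`); (iv) `sb_zE (hNW)`
  and `sb_zEpi` (NO hypothesis); `finiteOrderLiouvilleSchanuel_at_zE (hNW)` / `_at_zEpi`; `zE_outside_previous_cells`.

## The ladder (the lens; texts)
Scope of 33364 graded by the DIOPHANTINE TYPE of the non-Liouville datum over the prefix `(1, ℓ₂)`:
«log-hyper» (g34) ⊂ «log-square» (K-R19 γ, THIS NODE) ⊂ «log-log» (THIS NODE, the engine's exact reach) ⊂ «plain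
Liouville third coordinate» — OPEN: a Liouville `ρ` of finite log-log order (e.g. `Σ 3^{−k!}` relative to ℓ₂'s scales)
is below the induced measure; the honest floor of the single-scale method is `exp(−C log q · loglog q)` (the factor
`loglog` = one factorial step; removing it needs a measure of `θ` at the EXACT scale `2^{N!}` with `N! ≍ log len`, i.e.
a zero estimate for `Q(s_N, θ)` uniform in `N` — not attempted); «(ℓ₂, ℓ₂²)» / «(1, ℓ₂, ℓ₃)» = the wall (Generic21
`liouvilleNumber_sq_open_cell_status`).  Ceiling recorded, not attacked.
-/

noncomputable section

open Complex IntermediateField Polynomial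
open Summit.Schanuel.Schanuel.Theorems.RootDecomp1KHyper
open Summit.Schanuel.Schanuel.Theorems.RootDecomp1KHyper.HyperCell
open Summit.Schanuel.Schanuel.Theorems.RootDecomp1KGeneric
open Summit.Schanuel.Schanuel.Theorems.RootDecomp1KRelLiouvilleCell

namespace Summit.Schanuel.Schanuel.Theorems.RootDecomp1KLogLogCell

/-! ## §1  Two classes at the LOG · LOGLOG scale -/

/-- **Log-log measure of algebraic independence** of a tuple `θ` (EXPONENT-FREE): in every total degree `d`
there is `C > 0` with `|P(θ)| ≥ exp(−C·(1 + log len P)·(1 + log(1 + log len P)))` for all non-zero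
`P ∈ ℤ[X₁,…,Xₙ]` of total degree `≤ d`.  Strictly between the tree's `MvPolyMeasure` (`|P(θ)| ≥ (C lenᵗ)⁻¹`)
and g34's `LogPowMeasure` (`exp(−(C(1 + log len))^k)`). -/
def LogLogMeasure {n : ℕ} (θ : Fin n → ℂ) : Prop :=
  ∀ d : ℕ, ∃ C : ℝ, 0 < C ∧ ∀ P : MvPolynomial (Fin n) ℤ, P ≠ 0 → P.totalDegree ≤ d →
    Real.exp (-(C * (1 + Real.log ((mvlen P : ℤ) : ℝ)) *
      (1 + Real.log (1 + Real.log ((mvlen P : ℤ) : ℝ))))) ≤ ‖MvPolynomial.aeval θ P‖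

/-- **Log-log-Liouville reals**: for every `m` there are rationals `r` of arbitrarily large denominator `q`
with `|ρ − r| < exp(−m · log q · log log q) = q^{−m log log q}`.  Strictly between the tree's `LogSqLiouville`
(`q^{−m log q}`) and Mathlib's `Liouville` (`q^{−m}`). -/
def LogLogLiouville (ρ : ℝ) : Prop :=
  ∀ m : ℕ, ∃ r : ℚ, m ≤ r.den ∧ ρ ≠ r ∧
    |ρ - r| < Real.exp (-((m : ℝ) * Real.log r.den * Real.log (Real.log r.den)))

/-- A tuple with a log-log measure annihilates no nonzero integer polynomial. -/
theorem mvaeval_ne_zero_of_logLogMeasure {n : ℕ} {θ : Fin n → ℂ} (hθ : LogLogMeasure θ)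
    {P : MvPolynomial (Fin n) ℤ} (hP : P ≠ 0) : MvPolynomial.aeval θ P ≠ 0 := by
  intro h0
  obtain ⟨C, _, h⟩ := hθ P.totalDegree
  have h1 := h P hP le_rfl
  rw [h0, norm_zero] at h1
  exact absurd h1 (not_le.mpr (Real.exp_pos _))

/-- `1 ≤ 1 + log L` and `1 ≤ 1 + log (1 + log L)` for `L ≥ 1`. -/
private theorem one_le_loglog {L : ℝ} (hL : 1 ≤ L) :
    1 ≤ 1 + Real.log L ∧ 1 ≤ 1 + Real.log (1 + Real.log L) := by
  have h1 : 0 ≤ Real.log L := Real.log_nonneg hL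
  exact ⟨by linarith, by linarith [Real.log_nonneg (show (1 : ℝ) ≤ 1 + Real.log L by linarith)]⟩

/-- `1 + log u ≤ u` for `u ≥ 1` (so the log-log scale is below the log-square scale). -/
private theorem one_add_log_le_self {u : ℝ} (hu : 1 ≤ u) : 1 + Real.log u ≤ u := by
  have := Real.log_le_sub_one_of_pos (show 0 < u by linarith); linarith

/-- `MvPolyMeasure ⇒ LogLogMeasure` (`1/(C Lᵗ) ≥ exp(−(C+τ)(1 + log L)) ≥ exp(−(C+τ)(1+log L)(1+loglog))`). -/
theorem logLogMeasure_of_mvPolyMeasure {n : ℕ} {θ : Fin n → ℂ} (hθ : MvPolyMeasure θ) :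
    LogLogMeasure θ := by
  intro d
  obtain ⟨C, τ, hC, h⟩ := hθ d
  refine ⟨C + τ, by positivity, fun P hP hdeg => ?_⟩
  have h1 := h P hP hdeg
  set L : ℝ := ((mvlen P : ℤ) : ℝ) with hL
  have hL1 : 1 ≤ L := by rw [hL]; exact_mod_cast one_le_mvlen hP
  have hLpos : 0 < L := by linarith
  obtain ⟨hu1, hv1⟩ := one_le_loglog hL1
  have hprod : 0 < C * L ^ τ := by positivity
  have h2 : (C * L ^ τ)⁻¹ ≤ ‖MvPolynomial.aeval θ P‖ := by
    rw [inv_le_iff_one_le_mul₀' hprod]; simpa [mul_assoc] using h1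
  refine le_trans ?_ h2
  rw [← Real.exp_log hprod, ← Real.exp_neg]
  refine Real.exp_le_exp.mpr (neg_le_neg ?_)
  rw [Real.log_mul hC.ne' (by positivity), Real.log_pow]
  have hlogC : Real.log C ≤ C := (Real.log_le_sub_one_of_pos hC).trans (by linarith)
  have hlogL : 0 ≤ Real.log L := Real.log_nonneg hL1
  have e1 : (C + τ) * (1 + Real.log L) * 1 ≤ (C + τ) * (1 + Real.log L) * (1 + Real.log (1 + Real.log L)) :=
    mul_le_mul_of_nonneg_left hv1 (by positivity)
  nlinarith [mul_nonneg hC.le hlogL, (Nat.cast_nonneg τ : (0:ℝ) ≤ τ)]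

/-- `LogLogMeasure ⇒ LogPowMeasure` (with `k = 2`: `C u (1 + log u) ≤ C u²`). -/
theorem LogLogMeasure.logPowMeasure {n : ℕ} {θ : Fin n → ℂ} (hθ : LogLogMeasure θ) :
    LogPowMeasure θ := by
  intro d
  obtain ⟨C, hC, h⟩ := hθ d
  refine ⟨C, 2, hC, fun P hP hdeg => le_trans ?_ (h P hP hdeg)⟩
  set u : ℝ := 1 + Real.log ((mvlen P : ℤ) : ℝ) with hu
  have hL1 : (1 : ℝ) ≤ ((mvlen P : ℤ) : ℝ) := by exact_mod_cast one_le_mvlen hP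
  have hu1 : 1 ≤ u := (one_le_loglog hL1).1
  have hv : 1 + Real.log u ≤ u := one_add_log_le_self hu1
  refine Real.exp_le_exp.mpr (neg_le_neg ?_)
  calc C * u * (1 + Real.log u) ≤ C * u * u := mul_le_mul_of_nonneg_left hv (by positivity)
    _ = C * u ^ 2 := by ring

/-- `LogLogMeasure ⇒ MvWeakMeasure`. -/
theorem LogLogMeasure.mvWeakMeasure {n : ℕ} {θ : Fin n → ℂ} (hθ : LogLogMeasure θ) :
    MvWeakMeasure θ := hθ.logPowMeasure.mvWeakMeasure

/-- A tuple with a log-log measure is algebraically independent over `ℚ`. -/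
theorem algebraicIndependent_of_logLogMeasure {n : ℕ} {θ : Fin n → ℂ} (hθ : LogLogMeasure θ) :
    AlgebraicIndependent ℚ θ := algebraicIndependent_of_logPowMeasure hθ.logPowMeasure

/-- `log (log q) ≤ log q` (with Lean's `log 0 = 0` this holds for every `q ≥ 1`). -/
private theorem log_log_le_log {x : ℝ} (hx : 0 ≤ Real.log x) : Real.log (Real.log x) ≤ Real.log x := by
  rcases hx.eq_or_lt with h | h
  · rw [← h, Real.log_zero]
  · exact (Real.log_le_sub_one_of_pos h).trans (by linarith)

/-- `LogSqLiouville ⇒ LogLogLiouville` (`m (log q)² ≥ m · log q · log log q`): the tree's LOG-SQUARE class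
(lens 6 g14, `RootDecomp1KGeneric17`) lies inside the log-log class. -/
theorem logLogLiouville_of_logSqLiouville {ρ : ℝ} (hρ : LogSqLiouville ρ) : LogLogLiouville ρ := by
  intro m
  obtain ⟨r, hden, hne, hlt⟩ := hρ m
  refine ⟨r, hden, hne, hlt.trans_le (Real.exp_le_exp.mpr (neg_le_neg ?_))⟩
  have hq1 : (1 : ℝ) ≤ r.den := by exact_mod_cast r.den_pos
  have hlog : 0 ≤ Real.log (r.den : ℝ) := Real.log_nonneg hq1
  have h1 := log_log_le_log hlog
  have hm : (0 : ℝ) ≤ (m : ℝ) * Real.log r.den := by positivity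
  calc (m : ℝ) * Real.log r.den * Real.log (Real.log r.den) ≤ (m : ℝ) * Real.log r.den * Real.log r.den :=
        mul_le_mul_of_nonneg_left h1 hm
    _ = (m : ℝ) * Real.log r.den ^ 2 := by ring

/-- `LogHyperLiouville ⇒ LogLogLiouville` (g34's class, via the tree's `LogHyperLiouville.logSqLiouville`:
log-hyper ⇒ log-square ⇒ log-log). -/
theorem logLogLiouville_of_logHyperLiouville {ρ : ℝ} (hρ : LogHyperLiouville ρ) : LogLogLiouville ρ :=
  logLogLiouville_of_logSqLiouville (LogHyperLiouville.logSqLiouville hρ)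

/-- `HyperLiouville ⇒ LogLogLiouville` (tree `HyperLiouville.logHyperLiouville`). -/
theorem logLogLiouville_of_hyperLiouville {ρ : ℝ} (hρ : HyperLiouville ρ) : LogLogLiouville ρ :=
  logLogLiouville_of_logHyperLiouville (HyperLiouville.logHyperLiouville hρ)

/-- `4 log 2 ≥ e`, i.e. `log 16 ≥ exp 1`: so `log log q ≥ 1` once `q ≥ 16`. -/
private theorem one_le_log_log_of_sixteen_le {x : ℝ} (hx : 16 ≤ x) : 1 ≤ Real.log (Real.log x) := by
  have h2 := Real.log_two_gt_d9
  have he := Real.exp_one_lt_d9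
  have h16 : Real.log 16 = 4 * Real.log 2 := by
    rw [show (16 : ℝ) = 2 ^ 4 by norm_num, Real.log_pow]; norm_num
  have hlog16 : Real.exp 1 ≤ Real.log x := by
    refine le_trans ?_ (Real.log_le_log (by norm_num) hx)
    rw [h16]; linarith
  rw [← Real.log_exp 1]
  exact Real.log_le_log (Real.exp_pos 1) hlog16

/-- `1 ≤ log q` for `q ≥ 16` (crude). -/
private theorem one_le_log_of_sixteen_le {x : ℝ} (hx : 16 ≤ x) : 1 ≤ Real.log x := by
  rw [← Real.log_exp 1]
  refine Real.log_le_log (Real.exp_pos 1) (le_trans ?_ hx)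
  have := Real.exp_one_lt_d9; linarith

/-- `LogLogLiouville ⇒ Liouville`. -/
theorem LogLogLiouville.liouville {ρ : ℝ} (hρ : LogLogLiouville ρ) : Liouville ρ := by
  intro n
  obtain ⟨r, hden, hne, hlt⟩ := hρ (n + 16)
  have hq16 : (16 : ℝ) ≤ r.den := by exact_mod_cast (show 16 ≤ r.den by omega)
  have hqpos : (0 : ℝ) < r.den := by linarith
  have hr : (r : ℝ) = (r.num : ℝ) / ((r.den : ℤ) : ℝ) := by
    rw [Int.cast_natCast]; exact Rat.cast_def r
  refine ⟨r.num, r.den, by exact_mod_cast (show 1 < r.den by omega), hr ▸ hne, ?_⟩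
  rw [← hr]
  refine hlt.trans_le ?_
  have hll := one_le_log_log_of_sixteen_le hq16
  have hl := one_le_log_of_sixteen_le hq16
  have e1 : (1 : ℝ) / ((r.den : ℤ) : ℝ) ^ n = Real.exp (-((n : ℝ) * Real.log r.den)) := by
    rw [Int.cast_natCast, Real.exp_neg, ← Real.log_pow, Real.exp_log (by positivity), one_div]
  rw [e1, Real.exp_le_exp, neg_le_neg_iff]
  have h1 : (n : ℝ) * Real.log r.den ≤ ((n + 16 : ℕ) : ℝ) * Real.log r.den := by
    apply mul_le_mul_of_nonneg_right _ (by linarith); push_cast; linarith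
  have h2 : ((n + 16 : ℕ) : ℝ) * Real.log r.den * 1 ≤
      ((n + 16 : ℕ) : ℝ) * Real.log r.den * Real.log (Real.log r.den) :=
    mul_le_mul_of_nonneg_left hll (by positivity)
  linarith

/-- Log-log-Liouville reals are irrational. -/
theorem LogLogLiouville.irrational {ρ : ℝ} (h : LogLogLiouville ρ) : Irrational ρ := h.liouville.irrational

/-! ## §2  THE RATIONAL-ROOT NON-VANISHING LEMMA (replaces g34's non-root window)

If `gcd(a, q) = 1` and the integers `c₀, …, c_K` satisfy `|c_k| < q`, then `Σ_k c_k a^k q^{K−k} = 0` forces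
`c ≡ 0` (reduce mod `q`: `q ∣ c_K a^K`, so `q ∣ c_K`, so `c_K = 0`; divide by `q` and repeat).  Consequently,
for `Q ∈ ℤ[T, X⃗]`, `Q ≠ 0` with `len Q < q`: `q^K · Q(a/q, X⃗) ≠ 0` — a polynomial with small integer
coefficients has NO root at a reduced fraction with a LARGE denominator.  Over `(1, ℓ₂)` this means: at EVERY
scale `q = 2^{N!} > len Q` the partial sum `s_N = a/2^{N!}` (`a` odd) is not a root of `Q(·, θ⃗)`-cleared. -/

/-- **Lemma A (coefficients).** `gcd(a,q) = 1`, `|c_k| < q` for all `k`, `Σ_k a^k q^{K-k} c_k = 0 ⇒ c = 0`. -/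
private theorem eq_zero_of_sum_pow_mul_eq_zero {K : ℕ} (c : Fin (K + 1) → ℤ) {a : ℤ} {q : ℕ}
    (hcop : IsCoprime a (q : ℤ)) (hc : ∀ k, |c k| < q)
    (hsum : ∑ k : Fin (K + 1), a ^ (k : ℕ) * (q : ℤ) ^ (K - k) * c k = 0) : c = 0 := by
  induction K with
  | zero =>
    funext k
    obtain rfl : k = 0 := Fin.eq_zero k
    simpa using hsum
  | succ K ih =>
    rw [Fin.sum_univ_castSucc] at hsum
    simp only [Fin.val_castSucc, Fin.val_last, Nat.sub_self, pow_zero, mul_one] at hsum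
    have hq0 : (q : ℤ) ≠ 0 := by
      have h1 := hc 0; have h2 := abs_nonneg (c 0); omega
    -- `q ∣ a^{K+1} c_last`
    have hdvd : (q : ℤ) ∣ a ^ (K + 1) * c (Fin.last (K + 1)) := by
      have e : a ^ (K + 1) * c (Fin.last (K + 1)) =
          -(∑ k : Fin (K + 1), a ^ (k : ℕ) * (q : ℤ) ^ (K + 1 - k) * c k.castSucc) := by linarith
      rw [e]
      refine (Finset.dvd_sum fun k _ => ?_).neg_right
      have hk : K + 1 - (k : ℕ) = (K - k) + 1 := by have := k.2; omega
      rw [hk, pow_succ]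
      exact Dvd.intro_left (a ^ (k : ℕ) * (q : ℤ) ^ (K - (k : ℕ)) * c k.castSucc) (by ring)
    have hlast : c (Fin.last (K + 1)) = 0 := by
      have h1 : (q : ℤ) ∣ c (Fin.last (K + 1)) := (hcop.symm.pow_right).dvd_of_dvd_mul_left hdvd
      exact Int.eq_zero_of_abs_lt_dvd h1 (hc _)
    -- divide the rest by `q`
    have hrest : ∑ k : Fin (K + 1), a ^ (k : ℕ) * (q : ℤ) ^ (K - k) * c k.castSucc = 0 := by
      have e : (q : ℤ) * ∑ k : Fin (K + 1), a ^ (k : ℕ) * (q : ℤ) ^ (K - k) * c k.castSucc = 0 := by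
        rw [hlast, mul_zero, add_zero] at hsum
        rw [Finset.mul_sum, ← hsum]
        refine Finset.sum_congr rfl fun k _ => ?_
        have hk : K + 1 - (k : ℕ) = (K - k) + 1 := by have := k.2; omega
        rw [hk, pow_succ]; ring
      exact (mul_eq_zero.mp e).resolve_left hq0
    have ih' := ih (fun k => c k.castSucc) (fun k => hc _) hrest
    funext k
    cases k using Fin.lastCases with
    | last => exact hlast
    | cast i => exact congr_fun ih' i

/-- **Lemma A for slices.** If some slice `G_k ∈ ℤ[X⃗]` is non-zero, all slices have length `< q`, and
`gcd(a, q) = 1`, then the integer specialisation `Σ_k a^k q^{K−k} G_k = q^K · (Σ_k G_k Y^k)(Y := a/q)` is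
non-zero. -/
theorem mvspecialise_ne_zero_of_coprime {n K : ℕ} (G : Fin (K + 1) → MvPolynomial (Fin n) ℤ)
    (hG : ∃ k, G k ≠ 0) {a : ℤ} {q : ℕ} (hcop : IsCoprime a (q : ℤ))
    (hlen : ∀ k, mvlen (G k) < q) : mvspecialise G a q ≠ 0 := by
  classical
  obtain ⟨k₀, hk₀⟩ := hG
  obtain ⟨m, hm⟩ := MvPolynomial.ne_zero_iff.mp hk₀
  intro h0
  have hcoef := coeff_mvspecialise G a q m
  rw [h0, MvPolynomial.coeff_zero] at hcoef
  have hc : ∀ k, |(G k).coeff m| < (q : ℤ) := fun k =>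
    (abs_coeff_le_mvlen _ _).trans_lt (hlen k)
  have hall := eq_zero_of_sum_pow_mul_eq_zero (fun k => (G k).coeff m) hcop hc hcoef.symm
  exact hm (congr_fun hall k₀)

/-- **Lemma A over `ℤ[T, X⃗]` (the statement used on the cell).** For `Q ∈ ℤ[X₀, X₁, …, Xₙ]`, `Q ≠ 0`, of
`X₀`-degree `K`, with `len Q < q` and `gcd(a, q) = 1`: the integer polynomial `H = Σ_k a^k q^{K-k} Q_k(X⃗)`
(`Q = Σ_k Q_k(X⃗) X₀^k`) is NON-ZERO, and `H(θ⃗) = q^K · Q(a/q, θ⃗)` for every `θ⃗`. -/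
theorem specialise_ne_zero_of_coprime {n : ℕ} (Q : MvPolynomial (Fin (n + 1)) ℤ) (hQ : Q ≠ 0)
    {a : ℤ} {q : ℕ} (hq : q ≠ 0) (hcop : IsCoprime a (q : ℤ)) (hlen : mvlen Q < q) :
    mvspecialise (fun k : Fin ((MvPolynomial.finSuccEquiv ℤ n Q).natDegree + 1) => ycoeff Q k) a q ≠ 0 ∧
    ∀ θ : Fin n → ℂ, MvPolynomial.aeval θ
        (mvspecialise (fun k : Fin ((MvPolynomial.finSuccEquiv ℤ n Q).natDegree + 1) => ycoeff Q k) a q) =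
      (q : ℂ) ^ (MvPolynomial.finSuccEquiv ℤ n Q).natDegree *
        MvPolynomial.aeval (Fin.cons ((a : ℂ) / q) θ : Fin (n + 1) → ℂ) Q := by
  set K : ℕ := (MvPolynomial.finSuccEquiv ℤ n Q).natDegree with hK
  refine ⟨mvspecialise_ne_zero_of_coprime _ ⟨Fin.last K, ?_⟩ hcop fun k => ?_, fun θ => ?_⟩
  · have hne : MvPolynomial.finSuccEquiv ℤ n Q ≠ 0 := (EmbeddingLike.map_ne_zero_iff).mpr hQ
    have h1 := Polynomial.leadingCoeff_ne_zero.mpr hne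
    rw [Polynomial.leadingCoeff] at h1
    simpa [ycoeff, hK] using h1
  · exact (mvlen_ycoeff_le Q k).trans_lt hlen
  · rw [mvaeval_mvspecialise _ a hq θ, mvaeval_cons_eq_sum Q θ _ le_rfl,
      ← Fin.sum_univ_eq_sum_range (fun k => MvPolynomial.aeval θ (ycoeff Q k) * ((a : ℂ) / q) ^ k) (K + 1)]

end Summit.Schanuel.Schanuel.Theorems.RootDecomp1KLogLogCell
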